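import Summits.ABC.ABC.Theses.DefiniteXi

/-!
# Round-2 ideator 5 (k = 5) — crux `SteinbergCore` (stmt-ABC-15024): typed support targets, no line

No idea card is filed this round (see `BarrierNotesIdeator5-r2.md`).  This file only TYPES the two
bookkeeping statements the notes recommend to planners/provers, so that they can be filed as support
items or `--supports stmt-ABC-15024` helpers without re-deriving the signatures:

* `SteinbergCorePrime` — the crux restricted to its binding instances `Nm = q` an odd prime (the only
  instances `DefiniteGlue`/`closes` consume);
* `steinbergCore_imp_prime` — the trivial specialisation (PROVED here);
* `CompositeCollapse := SteinbergCorePrime → SteinbergCore` — the converse, TRUE IN PRINT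
  (Takahashi 2001 Thm 2.3 for general indefinite discriminant `D`, Ribet–Takahashi / Helm 2007 degree
  ratio with a 6-unit Eisenstein correction on Frey classes, and the Eisenstein property of component
  groups at Eichler primes), which closes the "regime without a comparison theorem" of
  `Cruxes/SteinbergCore/Disproof.lean` §E3: for `ℓ ≥ 5` and admissible `Nm ∋ r`,
  `v_ℓ ξ(N/Nm;Nm) = v_ℓ deg_min − Σ_{p ∣ Nm} v_ℓ(c_p)`, hence `B-LHS(Nm) ≤ B-LHS(r)`.
-/

namespace Summit.ABC.ABC.Cruxes.SteinbergCore.Ideator5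

open Literature.NumberTheory.Automorphic Literature.NumberTheory.EllipticCurves

/-- The crux at prime quarantine only: for every odd prime `q ∣ N`,
`cps ξ(E; N/q, q) · ∏_{p ∣ N} v_p(Δ_min) ≤ C_ε N^(2+ε)`. -/
def SteinbergCorePrime : Prop :=
  ∀ ε : ℝ, 0 < ε → ∃ C : ℝ, ∀ a b : ℤ, IsCoprime a b → a * b * (a + b) ≠ 0 → ∀ (N : ℕ) [NeZero N],
    (freyCurve a b).conductorNorm ℤ = N → ∀ q : ℕ, q.Prime → q ≠ 2 → q ∣ N →
    ((brandtXi (N / q) q (fun n => (freyCurve a b).LFunction n) /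
        (ordProj[2] (brandtXi (N / q) q (fun n => (freyCurve a b).LFunction n)) *
          ordProj[3] (brandtXi (N / q) q (fun n => (freyCurve a b).LFunction n))) : ℕ) : ℝ) *
      ((∏ p ∈ N.primeFactors, ((freyCurve a b).minimalDiscriminantNorm ℤ).factorization p : ℕ) : ℝ) ≤
      C * (N : ℝ) ^ (2 + ε)

/-- The converse bookkeeping statement (true in print, see the module docstring): the prime instances
imply all admissible instances. Filed here only as a typed Prop. -/
def CompositeCollapse : Prop :=
  SteinbergCorePrime → Summit.ABC.ABC.Theses.DefiniteXi.SteinbergCore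

/-- Trivial direction: the crux specialises to its prime instances (`Nm := q`: `Odd q`,
`Squarefree q`, `q.primeFactors = {q}` of odd cardinality). PROVED. -/
theorem steinbergCore_imp_prime (h : Summit.ABC.ABC.Theses.DefiniteXi.SteinbergCore) :
    SteinbergCorePrime := by
  intro ε hε
  obtain ⟨C, hC⟩ := h ε hε
  refine ⟨C, fun a b hab h0 N _ hN q hq hq2 hqN => ?_⟩
  have hodd : Odd q := hq.odd_of_ne_two hq2
  have hsq : Squarefree q := Irreducible.squarefree hq
  have hcard : Odd q.primeFactors.card := by rw [hq.primeFactors]; simp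
  exact hC a b hab h0 N hN q hodd hsq hcard hqN

/-- So, given `CompositeCollapse`, the crux is EQUIVALENT to its prime form. -/
theorem steinbergCore_iff_prime (hcc : CompositeCollapse) :
    Summit.ABC.ABC.Theses.DefiniteXi.SteinbergCore ↔ SteinbergCorePrime :=
  ⟨steinbergCore_imp_prime, hcc⟩

end Summit.ABC.ABC.Cruxes.SteinbergCore.Ideator5
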